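import Summits.ResolutionOfSingularities.ResolutionOfSingularities.Theorems.HilbertSamuelEliminationSigmaMaxModificationsCorridor3SigmaSurfaceBadnessCure
import Summits.ResolutionOfSingularities.ResolutionOfSingularities.Theorems.HilbertSamuelEliminationSigmaMaxModificationsCorridor3SigmaSurfaceBadnessZero
import HarnessLib

/-!
# [OURS · L1 W4.2] σ-LAYER PHASE B′ — `Corridor3SigmaSurfaceBadnessCureLists`: THE MULTIPLICITY-LIST LAW OF THE CURE-CURVE STEP and THE COMPONENT PART OF `M`
# STRICTLY DROPS — `compMults (cureAlong Γs ζ) ζ = CureLaw.cureStep (compMults Γs ζ)`, `compMults (cureAlong Γs ζ) ζ' = compMults Γs ζ'` at every other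
# codimension-one point, hence `Σ_{ζ'} μ_{ζ'}` drops by `μ(l) − μ(cureStep l) ≥ 1` when the cured component is BAD (`Σ l ≥ 2`)
# (res-L1-w42-stub-1 DESIGN CHECK 2 (a) ON THE CARRIER; kernel `CureLaw.μ_cureStep_lt` p553245; carrier laws `…Corridor3SigmaSurfaceBadnessCure`; crux chain w42
# `SigmaMaxModifications` stmt-ResolutionOfSingularities-18506 / conjunct `SigmaMaxModificationsCorridor3` stmt-ResolutionOfSingularities-19249; helper of
# res-L1-w42-stub-1 (gen 6), `--supports stmt-…-19249 --as helper`, counted 0)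

HONEST FRAMING. OURS list bookkeeping (`List.filter`/`List.map` congruences) over the stalk/order laws of `…SurfaceBadnessCure` and the finiteness
`Boundary.codimOnePoints_finite` (`…SurfaceBadnessZero`). The CROSSING part of `M` (`X` non-increasing under `ℓ = 0` on a surface) and the run-level transport are
NOT in this file. NOTHING here is a statement of H. Hironaka's manuscript [Hironaka2017] nor of [CossartJannsenSaito2020]; no named fact. AI-written; AI review is
weaker than expert review.

## Contents (namespace `…Theorems.SigmaMaxModificationsCorridor3.Sigma`)

* `membersThrough_cureAlong` (the members of the cured list through a point), **`Boundary.compMults_cureAlong_self`** (`= cureStep`),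
  **`Boundary.compMults_cureAlong_of_ne`** (unchanged elsewhere), `Boundary.compBadness_cureAlong_lt_self` (bad component: `μ` drops),
  `Boundary.compBadness_cureAlong_of_ne`, **`Boundary.finsum_compBadness_cureAlong_lt`** (`Σ_{ζ'} μ` strictly drops), `Boundary.finsum_compBadness_cureAlong_le`.

VACUITY SELF-CHECK. `[2] ↦ [1,1]` (`μ: 2 ↦ 1`), `[3,1] ↦ [2,1]` (`5 ↦ 3`), `[1,1] ↦ [1]` (`1 ↦ 0`) — the kernel's `example`s; the hypotheses (regular integral
Noetherian carrier, non-zero members, `ζ` a codimension-one point of the configuration) are those of the regular-surface phase.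
-/

noncomputable section

set_option linter.dupNamespace false -- mandated namespace of this single-conjunct summit

open CategoryTheory AlgebraicGeometry TopologicalSpace IsLocalRing
open Summit.ResolutionOfSingularities.ResolutionOfSingularities.Theorems.CampaignW42
open Literature.AlgebraicGeometry.Resolution Literature.RingTheory.HilbertSamuel

namespace Summit.ResolutionOfSingularities.ResolutionOfSingularities.Theorems.SigmaMaxModificationsCorridor3.Sigma

universe u

open Scheme.IdealSheafData

section Lists

variable {D : Scheme.{u}}

/-- List kernel of the cure law: filtering by the new membership and mapping the new orders is «peel» of the old multiplicity list. [folklore] -/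
theorem List.filter_map_eq_peel_aux {α : Type*} (l : List α) (f g : α → ℕ) (p q : α → Prop) [DecidablePred p] [DecidablePred q]
    (hpq : ∀ a ∈ l, q a ↔ (p a ∧ 2 ≤ f a)) (hfg : ∀ a ∈ l, q a → g a = f a - 1) :
    (l.filter (q ·)).map g = (((l.filter (p ·)).map f).filter (2 ≤ ·)).map (· - 1) := by
  induction l with
  | nil => simp
  | cons a t ih =>
    have hpq' := fun b hb => hpq b (List.mem_cons_of_mem a hb)
    have hfg' := fun b hb => hfg b (List.mem_cons_of_mem a hb)
    by_cases hq : q a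
    · obtain ⟨hp, h2⟩ := (hpq a (by simp)).mp hq
      simp [hq, hp, h2, hfg a (by simp) hq, ih hpq' hfg']
    · by_cases hp : p a
      · have h2 : ¬ 2 ≤ f a := fun h2 => hq ((hpq a (by simp)).mpr ⟨hp, h2⟩)
        simp [hq, hp, h2, ih hpq' hfg']
      · simp [hq, hp, ih hpq' hfg']

/-- List kernel: same filter (up to equivalence on the list) and same values give the same filtered map. [folklore] -/
theorem List.filter_map_congr_aux {α β : Type*} (l : List α) (f g : α → β) (p q : α → Prop) [DecidablePred p] [DecidablePred q]
    (hpq : ∀ a ∈ l, q a ↔ p a) (hfg : ∀ a ∈ l, p a → g a = f a) : (l.filter (q ·)).map g = (l.filter (p ·)).map f := by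
  induction l with
  | nil => simp
  | cons a t ih =>
    have hpq' := fun b hb => hpq b (List.mem_cons_of_mem a hb)
    have hfg' := fun b hb => hfg b (List.mem_cons_of_mem a hb)
    by_cases hp : p a
    · have hq : q a := (hpq a (by simp)).mpr hp
      simp [hq, hp, hfg a (by simp) hp, ih hpq' hfg']
    · have hq : ¬ q a := fun h => hp ((hpq a (by simp)).mp h)
      simp [hq, hp, ih hpq' hfg']

open scoped Classical in
/-- **The members of the cured list through a point `x`**: the cures of the members whose cure passes through `x`, then `𝓟_ζ` if `ζ ⤳ x`. [folklore] -/
theorem membersThrough_cureAlong (Γs : Boundary D) (ζ x : D) :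
    membersThrough (Γs.cureAlong ζ) x =
      (Γs.filter fun Γ => x ∈ ((cureMember ζ Γ).support : Set D)).map (cureMember ζ) ++
        (if ζ ⤳ x then [primeDivisorIdeal ζ] else []) := by
  unfold membersThrough Boundary.cureAlong
  rw [List.filter_append, List.filter_map]
  refine congrArg₂ (· ++ ·) rfl ?_
  by_cases h : ζ ⤳ x
  · have : x ∈ (primeDivisorIdeal ζ).support := (mem_support_primeDivisorIdeal_iff ζ x).mpr h
    simp [this, h]
  · have : x ∉ (primeDivisorIdeal ζ).support := fun h' => h ((mem_support_primeDivisorIdeal_iff ζ x).mp h')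
    simp [this, h]

variable [IsIntegral D] [IsNoetherian D]

open scoped Classical in
/-- **THE MULTIPLICITY-LIST LAW AT THE CURED COMPONENT: `compMults (cureAlong Γs ζ) ζ = cureStep (compMults Γs ζ)`** — members with `ord_ζ ≥ 2` keep `ζ` with order
one less, members with `ord_ζ = 1` drop out, the new member `𝓟_ζ` enters last with order `1`. [folklore] -/
theorem Boundary.compMults_cureAlong_self (hreg : Scheme.IsRegular D) {Γs : Boundary D} (hne : ∀ Γ ∈ Γs, Γ ≠ ⊥) {ζ : D} (hζ : Order.coheight ζ = 1) :
    (Γs.cureAlong ζ).compMults ζ = CureLaw.cureStep (Γs.compMults ζ) := by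
  unfold Boundary.compMults CureLaw.cureStep CureLaw.peel
  rw [membersThrough_cureAlong, if_pos (specializes_refl ζ), List.map_append, List.map_singleton, idealOrder_primeDivisorIdeal_self' hζ]
  refine congrArg₂ (· ++ ·) ?_ (by rfl)
  unfold membersThrough
  rw [List.map_map]
  refine List.filter_map_eq_peel_aux Γs (fun Γ => (idealOrder Γ ζ).toNat) ((fun Γ => (idealOrder Γ ζ).toNat) ∘ cureMember ζ)
    (fun Γ => ζ ∈ (Γ.support : Set D)) (fun Γ => ζ ∈ ((cureMember ζ Γ).support : Set D)) (fun Γ hΓ => ?_) (fun Γ hΓ hq => ?_)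
  · by_cases h : ζ ∈ (Γ.support : Set D)
    · rw [mem_support_cureMember_self_iff hreg hζ (hne Γ hΓ) h]
      exact ⟨fun h2 => ⟨h, h2⟩, fun h2 => h2.2⟩
    · exact ⟨fun hq => absurd hq (not_mem_support_cureMember_of_not_mem h), fun h2 => absurd h2.1 h⟩
  · have h : ζ ∈ (Γ.support : Set D) := support_cureMember_subset ζ Γ hq
    exact toNat_idealOrder_cureMember_self hreg hζ (hne Γ hΓ) h

omit [AlgebraicGeometry.IsIntegral D] in
open scoped Classical in
/-- **AT EVERY OTHER CODIMENSION-ONE POINT THE MULTIPLICITY LIST IS UNCHANGED.** [folklore] -/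
theorem Boundary.compMults_cureAlong_of_ne (Γs : Boundary D) {ζ ζ' : D} (hζ : Order.coheight ζ = 1) (hζ' : Order.coheight ζ' = 1) (hne' : ζ ≠ ζ') :
    (Γs.cureAlong ζ).compMults ζ' = Γs.compMults ζ' := by
  have hns : ¬ ζ ⤳ ζ' := not_specializes_of_coheight_eq_one hζ hζ' hne'
  unfold Boundary.compMults
  rw [membersThrough_cureAlong, if_neg hns, List.append_nil]
  unfold membersThrough
  rw [List.map_map]
  refine List.filter_map_congr_aux Γs (fun Γ => (idealOrder Γ ζ').toNat) ((fun Γ => (idealOrder Γ ζ').toNat) ∘ cureMember ζ)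
    (fun Γ => ζ' ∈ (Γ.support : Set D)) (fun Γ => ζ' ∈ ((cureMember ζ Γ).support : Set D))
    (fun Γ _ => mem_support_cureMember_iff_of_not_specializes hns Γ) (fun Γ _ _ => ?_)
  simp only [Function.comp_apply]
  rw [idealOrder_cureMember_of_ne hζ hζ' hne']

/-- `μ` at the cured component: `μ(cureStep l)`. [folklore] -/
theorem Boundary.compBadness_cureAlong_self (hreg : Scheme.IsRegular D) {Γs : Boundary D} (hne : ∀ Γ ∈ Γs, Γ ≠ ⊥) {ζ : D} (hζ : Order.coheight ζ = 1) :
    (Γs.cureAlong ζ).compBadness ζ = CureLaw.μ (CureLaw.cureStep (Γs.compMults ζ)) := by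
  rw [Boundary.compBadness_eq, Boundary.compMults_cureAlong_self hreg hne hζ]

/-- **`μ` STRICTLY DROPS AT A BAD CURED COMPONENT** (kernel `CureLaw.μ_cureStep_lt`; multiplicities positive since the members are non-zero). [folklore] -/
theorem Boundary.compBadness_cureAlong_lt_self (hreg : Scheme.IsRegular D) {Γs : Boundary D} (hne : ∀ Γ ∈ Γs, Γ ≠ ⊥) {ζ : D} (hζ : Order.coheight ζ = 1)
    (hbad : 2 ≤ (Γs.compMults ζ).sum) : (Γs.cureAlong ζ).compBadness ζ < Γs.compBadness ζ := by
  rw [Boundary.compBadness_cureAlong_self hreg hne hζ, Boundary.compBadness_eq]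
  exact CureLaw.μ_cureStep_lt _ (Boundary.one_le_of_mem_compMults fun Γ hΓ => stalkIdeal_ne_bot_of_ne_bot (hne Γ hΓ) ζ) hbad

omit [AlgebraicGeometry.IsIntegral D] in
/-- `μ` elsewhere: unchanged. [folklore] -/
theorem Boundary.compBadness_cureAlong_of_ne (Γs : Boundary D) {ζ ζ' : D} (hζ : Order.coheight ζ = 1) (hζ' : Order.coheight ζ' = 1) (hne' : ζ ≠ ζ') :
    (Γs.cureAlong ζ).compBadness ζ' = Γs.compBadness ζ' := by
  rw [Boundary.compBadness_eq, Boundary.compBadness_eq, Boundary.compMults_cureAlong_of_ne Γs hζ hζ' hne']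

/-- **THE COMPONENT PART OF `M` DOES NOT INCREASE** under a cure step along any codimension-one point of the configuration. [folklore] -/
theorem Boundary.finsum_compBadness_cureAlong_le (hreg : Scheme.IsRegular D) {Γs : Boundary D} (hne : ∀ Γ ∈ Γs, Γ ≠ ⊥) {ζ : D} (hζ : ζ ∈ Γs.codimOnePoints) :
    ∑ᶠ ζ' ∈ (Γs.cureAlong ζ).codimOnePoints, (Γs.cureAlong ζ).compBadness ζ' ≤ ∑ᶠ ζ' ∈ Γs.codimOnePoints, Γs.compBadness ζ' := by
  have hfin := Boundary.codimOnePoints_finite hne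
  rw [Boundary.codimOnePoints_cureAlong hreg hζ, finsum_mem_eq_finite_toFinset_sum _ hfin, finsum_mem_eq_finite_toFinset_sum _ hfin]
  refine Finset.sum_le_sum fun ζ' hζ' => ?_
  rw [Set.Finite.mem_toFinset] at hζ'
  by_cases h : ζ = ζ'
  · subst h
    by_cases hbad : 2 ≤ (Γs.compMults ζ).sum
    · exact (Boundary.compBadness_cureAlong_lt_self hreg hne hζ.2 hbad).le
    · -- not bad: `compMults = [1]`-like lists; `μ (cureStep l) ≤ μ l` still holds via the exact drop formula? use: sum < 2 with positive entries ⇒ l = [1]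
      have hpos := Boundary.one_le_of_mem_compMults (Γs := Γs) (ζ := ζ) fun Γ hΓ => stalkIdeal_ne_bot_of_ne_bot (hne Γ hΓ) ζ
      have hnn := Boundary.compMults_ne_nil (Γs := Γs) hζ.1
      have h1 : Γs.compMults ζ = [1] := by
        by_contra hne1
        exact hbad ((CureLaw.two_le_sum_iff_ne_singleton_one _ hpos hnn).mpr hne1)
      rw [Boundary.compBadness_cureAlong_self hreg hne hζ.2, Boundary.compBadness_eq, h1]
      decide
  · rw [Boundary.compBadness_cureAlong_of_ne Γs hζ.2 hζ'.2 h]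

/-- **THE COMPONENT PART OF `M` STRICTLY DROPS WHEN THE CURED COMPONENT IS BAD** (`S_ζ ≥ 2`). [folklore] -/
theorem Boundary.finsum_compBadness_cureAlong_lt (hreg : Scheme.IsRegular D) {Γs : Boundary D} (hne : ∀ Γ ∈ Γs, Γ ≠ ⊥) {ζ : D} (hζ : ζ ∈ Γs.codimOnePoints)
    (hbad : 2 ≤ (Γs.compMults ζ).sum) :
    ∑ᶠ ζ' ∈ (Γs.cureAlong ζ).codimOnePoints, (Γs.cureAlong ζ).compBadness ζ' < ∑ᶠ ζ' ∈ Γs.codimOnePoints, Γs.compBadness ζ' := by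
  have hfin := Boundary.codimOnePoints_finite hne
  rw [Boundary.codimOnePoints_cureAlong hreg hζ, finsum_mem_eq_finite_toFinset_sum _ hfin, finsum_mem_eq_finite_toFinset_sum _ hfin]
  refine Finset.sum_lt_sum (fun ζ' hζ' => ?_) ⟨ζ, (Set.Finite.mem_toFinset hfin).mpr hζ, Boundary.compBadness_cureAlong_lt_self hreg hne hζ.2 hbad⟩
  rw [Set.Finite.mem_toFinset] at hζ'
  by_cases h : ζ = ζ'
  · subst h
    exact (Boundary.compBadness_cureAlong_lt_self hreg hne hζ.2 hbad).le
  · rw [Boundary.compBadness_cureAlong_of_ne Γs hζ.2 hζ'.2 h]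

end Lists

end Summit.ResolutionOfSingularities.ResolutionOfSingularities.Theorems.SigmaMaxModificationsCorridor3.Sigma

end
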